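import Mathlib
import HarnessLib
import HarnessLib.Audit
import Summits.ValiantsHypothesis.Statement
import Literature.Computability.AlgebraicComplexity.ValiantConjectureProofs
import Literature.Computability.AlgebraicComplexity.PermanentIrreducible
import Summits.ValiantsHypothesis.ValiantsHypothesis.Theorems.SliceSignRankPositiveSliceNormalFormSplitGlue

/-!
Route: SliceSignRank

DORMANT since 2026-09-03T13:36:38Z (reconciler: no traction for 5 d (last activity statement-checked at 2026-08-29T12:50:09Z); parked, not closed — `ledger route dormant route-ValiantsHypothesis-SliceSignRank --off` to reactivate) — unstaffed, not closed; items shared with open routes are served there. `ledger route dormant <id> --off` reactivates.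

# Route SliceSignRank — signs beat equations — all-positive slice polynomials are hard, via the
sign-rank of the Levi-Civita tensor

It suffices to show X = PPC, the POSITIVE-PATTERN THESIS (card positive-orthant-sign-elimination,
spine and only card; typed
item `PositivePatternHard`): no VP family over ℂ is supported on the permutation slice slice_n =
span{x^σ = Π_i x_{σ(i),i} : σ ∈ S_n}
with all n! coefficients real and positive — every polynomial-size circuit whose output lives on the
permutation monomials has a
non-positive coefficient. per_n is the all-ones point of that open orthant and lies in VNP, so X ⇒
per ∉ VP_ℂ ⇒ VP_ℂ ≠ VNP_ℂ (support
TargetToVH, three lines over proved hub facts). X is reached as SRK ∧ FNF⁺: SRK (`SignRankSuperQP`,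
rank 2) — the sign-rank with
don't-cares of the Levi-Civita tensor, srk(n) := least k such that k real rank-one twists W_1,…,W_k
make sgn σ · Σ_t Π_i W_t(σ(i),i) > 0
for every σ, is not quasi-polynomially bounded; FNF⁺ (`PositiveSliceNormalForm`, rank 3) — every
positive-orthant slice family in VP_ℂ
is, for all n ≥ 1, a sum of ≤ 2^((log₂ n + c)^c) REAL Hadamard-twisted determinants det(W_t ∘ X)
(stated coefficientwise; support
TwistedSumForm is the dictionary). The deciding theorem `closes : SignRankSuperQP →
PositiveSliceNormalForm → ValiantsHypothesis` is
certified (planner Sketch.lean, lean rc 0, no sorry).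
Lean: `∀ f : (n : ℕ) → MvPolynomial (Fin n × Fin n) ℂ, (∀ (n : ℕ) (d : Fin n × Fin n →₀ ℕ), (∀ ρ :
Equiv.Perm (Fin n), Literature.Computability.AlgebraicComplexity.permMonomial ρ ≠ d) →
MvPolynomial.coeff d (f n) = 0) → (∀ (n : ℕ) (ρ : Equiv.Perm (Fin n)), ∃ r : ℝ, 0 < r ∧
MvPolynomial.coeff (Literature.Computability.AlgebraicComplexity.permMonomial ρ) (f n) = (r : ℂ)) →
¬ Literature.Computability.AlgebraicComplexity.IsVPFamily f`

## Assembly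
Pure logic over PROVED tree facts, certified sorry-free as `closes` in the planner's Sketch.lean /
glue.lean (axioms propext,
Classical.choice, Quot.sound): `ValiantsHypothesis` unfolds to VP ℂ ≠ VNP ℂ; under VP ℂ = VNP ℂ the
permanent family is an IsVPFamily
(`perFamily_mem_VNP_holds`, `mem_VP_ofFintype_iff_holds`); it is slice-supported with all
coefficients 1 (`coeff_perPoly`,
`coeff_permMonomial_perPoly`), so FNF⁺ yields c and, at n = max(n₀(c), 1), k ≤ 2^((log₂ n + c)^c)
real twists with
1 = sgn σ · Σ_t Π_i W_t(σ i, i) in ℂ for every σ; `Complex.ofReal_injective` + `push_cast` make this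
a real identity, hence a positive
sign-representation of length k, which SRK at c forbids. Both cruxes are hypotheses of `closes` and
both are used; no support item is a
hypothesis (crux-only ruling 2026-08-16) — CruxesToTarget / TargetToVH record the same argument
through the target.

Rationale: WHY THIS LINE. Pólya (1913) asked whether ONE sign pattern turns det into per and Marcus–Minc /
Brualdi–Shader / RobertsonSeymourThomas1999 / McCuaig2004
settled the single-signing (k = 1) conversion problem; Valiant's hypothesis says no quasi-polynomial
number of cancelling determinants
reaches per; between them sits one integer sequence srk(n) = 2, 2, 4, … (exact small-n data of the
card, replicated here for n = 3, 4)
that RELAXES "= per" to "all permutation coefficients positive" and ℂ to ℝ. The relaxation is the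
lever: (i) the hard set becomes the
open, Zariski-DENSE orthant P_n^+ of the slice, so the route's certificates are inequalities, not
vanishing distinguishers — outside the
algebraically-natural-proofs format of ForbesShpilkaVolk2018 / GrochowKumarSaksSaraf2017 by
construction; (ii) every flattening is
provably blind (each bipartition of the rows admits a rank-one sign completion), yet a scale-free
SIGN-ELIMINATION engine — restrict to a
coset cube of ⌊n/2⌋ disjoint row transpositions where sgn is parity, eliminate a term that is "even"
on a block (Minsky–Papert style),
Mantel's theorem on the triangle-free (bipartite) graph of odd column pairs, and the Radon relation
of the six 3×3 permutation matrices —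
already gives srk(n) ≥ n/4 − O(√(n log n)) for ALL positive patterns at once, without
Mignon–Ressayre (support SignRankLinearLower);
(iii) Hadamard's inequality makes every single coboundary twist of sgn pseudorandom against
degree-cn tests on the Birkhoff vertices, so
all one-signing constructions need 2^Ω(n) determinants and small srk must MIX signings (the content
of crux 1). Imported areas: sign-rank /
unbounded-error communication complexity (Forster2002, RazborovSherstov2010), threshold-degree lower
bounds (Minsky–Papert), Boolean
function complexity on S_n (DafniEtAl2020), extremal graph theory (Mantel) and the oriented-matroid
structure of the Birkhoff polytope
(Radon/Klein relations); the Pfaffian-orientation literature (LoeblMasbaum2011, Tesler2000) is the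
exact/unit-weight ancestor. What no
open route does: TwistedDetRank asks for EXACT complex representations of per_n itself (toric secant
rank of sgn, Mignon–Ressayre-based
n/2 bound) and transfers on the class-function slice; ImmanantSlice uses degree-one (linear)
distinguishers on class functions;
OneNatPerBit / FreeFermionCLL measure archimedean angles; DivisionGap / CirculantFourier charge
monotone computation. None relaxes to an
orthant, none has a sign-only engine, and SRK can fail (an O(n) mixed-signing scheme) while
tdr_ℂ(per_n) stays exponential — a
different bet on a different object. Negatives index (4 refuted statements: elusive Sidon candidate,
UlrichPadded NoTightInfinity,
GrenetRigidity optimal-unique ×2) is untouched.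

RANKED CRUXES. #0 PositivePatternHard (target) — PPC in family form: a family f_n ∈ ℂ[x_ij]
supported on the permutation monomials with every permutation coefficient real and positive is not a
VP family (card thesis PPC; per_n is the all-ones instance). (why it might fail: strictly stronger
than VH: ONE easy all-positive slice family kills it — candidates whose complexity is open:
q-determinants Σ q^inv(σ) x^σ (q > 0, q ≠ 1; arXiv:2605.24349), positive fermionants Σ t^cyc(σ)
x^σ.) [MarcusMinc1961, McCuaig2004, RobertsonSeymourThomas1999, Valiant1979, arXiv:2605.24349]
#2 SignRankSuperQP (crux) — HELD since rev 3 (a.e. form; OUT of the binders of `closes`, implies the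
binder SrkNotQP by the landed `srkNotQP_of_signRankSuperQP`; never a second binder; its registered
line `birth` is open modulo `stub_forsterSlice` only, see NOT DECOMPOSED YET) — SRK (card K1): the
sign-rank with don't-cares of the Levi-Civita tensor is not quasi-polynomially bounded — for every
c, for all large n, no k ≤ 2^((log₂ n + c)^c) real matrices W_1..W_k ∈ ℝ^(n×n) satisfy sgn σ · Σ_t
Π_i W_t(σ(i), i) > 0 for every σ ∈ S_n (equivalently: no sum of k real Hadamard-twisted determinants
has all n! permutation coefficients positive). [difficulty: open-problem] (why it might fail: every
product-structure restriction (coset cubes, S_m^r cosets, LP recursion) caps the engine at O(n);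
single signings are exponential (Thm D) but a MIXED-signing scheme with k = O(n) or poly(n) terms
(as in the n = 4, k = 2 witness) is not excluded by anything proved.) [Forster2002,
RazborovSherstov2010, MarcusMinc1961, LoeblMasbaum2011, DafniEtAl2020]
#3 PositiveSliceNormalForm (crux) — DERIVED PARENT since rev 3 (SPLIT gen 1 into #301 SrkNotQP ∧
#302 PositiveSliceSignTransfer, glue `PositiveSliceNormalFormGlueBy_holds` = landed
`…SliceSignRankPositiveSliceNormalFormSplitGlue.positiveSliceNormalForm_of_subs`; HELD --needs
20857,20858; a direct proof stays welcome at low priority) — FNF⁺ (card K2 restricted to the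
positive orthant, the weakest transfer under which SRK decides VH): for every VP_ℂ family f
supported on the permutation slice with all permutation coefficients real and positive there is c
such that for all n ≥ 1 the coefficient function is a REAL fermionic sum of length k ≤ 2^((log₂ n +
c)^c): coeff(x^σ, f_n) = sgn σ · Σ_(t<k) Π_i W_t(σ(i), i) with W_t ∈ ℝ^(n×n) — i.e. f_n = Σ_t
det(W_t ∘ X) (support TwistedSumForm). [deps: SignRankSuperQP] [difficulty: open-problem] (why it
might fail: structural transfer with no mechanism yet; given SRK it is equivalent to PPC, so one
easy positive slice family of large real twisted rank (q-determinant, if easy) kills it; a proof may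
need equations of VP on the slice, blind to cancellation of non-permutation monomials.)
[Valiant1979, Burgisser2000, HrubesYehudayoff2011, Tesler2000, Curticapean2021]
#301 SrkNotQP (crux) — ATTACKED CONJUNCT (rev 5) · BINDER of `closes` rev 3 (stmt-20857; split child
1 of PositiveSliceNormalForm) · registered line `forster_slice`
(Cruxes/SrkNotQP/Lines/forster_slice.lean, open stub `stub_forsterSlice` only; state and calibration
in NOT DECOMPOSED YET): SRK∞, the infinitely-often form — for every c there is an n ≥ 1 such that no
k ≤ 2^((log₂ n + c)^c) real twists W_t sign-represent sgn on S_n (sgn σ · Σ_t Π_i W_t(σ i, i) > 0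
∀σ); implied by #2 (landed `srkNotQP_of_signRankSuperQP`). (why it might fail: a MIXED-sign scheme
with poly(n) product terms may exist for all large n — cancellations help: srk(4) = 2 < 3 =
positive-orthant bound; every known engine (Marcus–Minc, Forster-type) caps at k = O(n).)
[Forster2002, RazborovSherstov2010, MarcusMinc1961, LoeblMasbaum2011]
#302 PositiveSliceSignTransfer (crux) — RESIDUAL · HELD (not staffed) since rev 5 · BINDER of
`closes` rev 3 (stmt-20858; split child 2): SGN-TRANSFER — every VP family supported on the
permutation slice with strictly positive real permutation coefficients admits, for all n ≥ 1, a real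
sign-representation of sgn of quasi-polynomial length (the sign-only weakening of FNF⁺; implied by
#3 and by PositivePatternHard, calibrations landed in
Theorems/SliceSignRankPositiveSliceNormalFormSplit.lean). (why it might fail: one EASY
positive-slice family of super-quasi-polynomial sign-rank kills it (positive fermionants /
q-determinants if any is in VP); no transfer mechanism from circuits to sign-representations is
known beyond read-once/multilinear normal forms.) [Valiant1979, Burgisser2000, HrubesYehudayoff2011,
arXiv:2605.24349] DECLARED THIS ROUTE'S RESIDUAL = the imported complement of the conjunct split
FNF⁺ ⇐ SrkNotQP ∧ T (tribunal conjunct rule; tenure g7 2026-08-27, on the crux-plan verdict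
Cruxes/PositiveSliceSignTransfer/NO-SKELETON.md of val-width-lines-3): MODULO THE SIBLING BINDER
SrkNotQP, T ⟺ PPC = the target #0 (≥ VH) — kernel,
Theorems/SliceSignRankPositiveSliceNormalFormSplit.lean:
`positiveSliceSignTransfer_of_positivePatternHard` (PPC → T, vacuously),
`positivePatternHard_of_subs` and `valiantsHypothesis_of_subs` (SrkNotQP ∧ T → PPC → VH); T alone is
not known to give VH (the per/HC block-swap flattening of
Theorems/SliceSignRankPositiveSliceNormalFormSummitHard.lean kills FNF⁺-alone, not T-alone). Every
cut of T considered — VSBR normal form (the qp-formula stub is ≥ T: costume), the model ladder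
twisted sums ⊂ read-once rank-one determinantal (= permutation-indexed principal minors of one n²×n²
matrix, by the matrix-determinant lemma) ⊂ ABP ⊂ formula ⊂ circuit (a rung plus a crux-strength
residual; Raz's set-multilinearisation is polynomial only for degree O(log n/log log n), Landsberg
2017 Thm 7.4.3.2), and the negation line (needs an EASY positive slice family AND SRK∞) — is costume
or crux-strength, so NO skeleton is registered and no prover or stub-worker is seated (item HELD on
the ledger). The first honest stub of a T-line would be a lever «positive permutation principal
minors ⇒ short real sign-representation of sgn» with the read-once determinantal rung as
`stub_readOnceDet`; file it then and lift the hold.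
#9 CruxesToTarget (support) — SRK and FNF⁺ give PPC: a positive slice VP family would have
quasi-polynomial real sign-representations of sgn for all n ≥ 1, contradicting SRK at n = max(n₀, 1)
(pure logic; planner Sketch.lean `cruxesToTarget_holds`). [difficulty: provable-now] [Valiant1979]
#9 TargetToVH (support) — PPC decides the summit: per_n is supported on the permutation monomials
with all coefficients 1 (`coeff_perPoly`, `coeff_permMonomial_perPoly`), per ∈ VNP
(`perFamily_mem_VNP_holds`) and the renaming bridge `mem_VP_ofFintype_iff_holds` turn VP ℂ = VNP ℂ
into IsVPFamily per, contradicting PPC. [difficulty: provable-now] [Valiant1979, Burgisser2000]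
#9 SignRankLinearLower (support) — card Theorem A in O-form (the engine's first theorem): there is
an absolute C with n ≤ C·k whenever k real twists sign-represent sgn on S_n (card: srk(n) ≥ n/4 −
O(√(n log n)) by coset-cube elimination + Mantel + random pairing; k ≥ 1 always since the empty sum
is 0). [difficulty: M] [Forster2002, MarcusMinc1961]
#9 PolyaOneTwist (support) — Pólya / Marcus–Minc in sign form: for n ≥ 3 no single real twist W has
sgn σ · Π_i W(σ(i), i) > 0 for all σ (restrict to S_3 ⊕ id; the products over even and over odd
permutations of the 3×3 block coincide but carry opposite signs). [difficulty: provable-now]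
[MarcusMinc1961, McCuaig2004]
#9 TwistedSumForm (support) — dictionary (folklore, `Matrix.det_apply'` + distinctness of
permutation monomials): for a slice-supported f ∈ ℂ[x_ij] and real twists W_1..W_k, the coefficient
identity coeff(x^σ, f) = sgn σ · Σ_t Π_i W_t(σ(i), i) for all σ holds iff f = Σ_t det(W_t ∘ X) as
polynomials. [difficulty: provable-now] [Burgisser2000, MarcusMinc1961]

TWO-LAYER PLAN. Foreseen glued splits once work starts (nothing filed now): SignRankSuperQP ⇐
SrkSuperlinear (srk(n) ≠ O(n): the first rung past the
engine's product-structure ceiling) → SrkMixedSigningStructure (a k-term sign-representation forces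
≥ k/poly "essentially different"
signings, extending the k = 2 structure theorem: two signings + an assignment-functional tie-break)
→ SignRankSuperQP; and
PositiveSliceNormalForm ⇐ FNF⁺ for formulas/ABPs (slice parts of torus-graded ABPs are short twisted
sums) → circuits.

KILL CRITERIA. A mixed-signing construction with k = poly(n) (all permutation coefficients of
Σ_(t<k) det(W_t ∘ X) positive) refutes SignRankSuperQP —
close `refuted:SignRankSuperQP` (PPC may survive in other models, but this route's engine is dead;
hand the construction to TwistedDetRank
as an upper-bound datum). An easy all-positive slice family (e.g. q-determinant in VP) refutes
PositivePatternHard and, given SRK,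
PositiveSliceNormalForm — close `refuted:PositiveSliceNormalForm`. A proof elsewhere of per ∉ VP
moots the route; a proof of
TwistedDetRank.FermionicNormalForm does NOT (different slice). DECIDING THEOREM rev 3 (tenure g2,
director-valiant g8 2026-08-27T17:52:55Z (d)): `closes (hK : SrkNotQP) (hT :
PositiveSliceSignTransfer) : ValiantsHypothesis` — the split children are the load-bearing binders,
PositiveSliceNormalForm is derived inside the proof, SignRankSuperQP is held context; a refutation
of SrkNotQP (a poly/quasi-poly mixed signing for ALL large n) closes the route `refuted:SrkNotQP`
exactly as for SignRankSuperQP above. RESIDUAL BOOKKEEPING (rev 5, tenure g7):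
PositiveSliceSignTransfer (#302) is NOT attacked on this route; the route's live mathematics is
SrkNotQP (#301, VH-free: the sign-rank of sgn on S_n). A refutation of #301 closes the route as
above; a PROOF of #301 banks a sign-rank theorem and leaves the route standing on the residual T ≡
PPC (mod SRK∞), i.e. on its own target — at that point SliceSignRank is SUMMIT-CALIBRATED and goes
dormant unless a T-lever (see #302) has appeared; an easy positive slice family of
super-quasi-polynomial real sign-rank refutes T and PPC together
(`refuted:PositiveSliceSignTransfer` = KILL clause 2).

NOT DECOMPOSED YET. STATE OF THE SRK LINE (director-valiant g8 2026-08-27T19:03:39Z):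
SignRankSuperQP's registered skeleton `birth` (Cruxes/SignRankSuperQP/Lines/birth.lean; composition
`SignRankSuperQP_of : stub_forsterSlice → stub_vdwHadamard → SignRankSuperQP` PROVED) has stub B
`stub_vdwHadamard` (van der Waerden–Hadamard: n!·det(V)² ≤ nⁿ·per(V∘V)) LANDED — p558422
`Theorems/SliceSignRankSignRankSuperQPVdwHadamard.lean`, decl
`Summit.ValiantsHypothesis.ValiantsHypothesis.Theorems.SliceSignRank.SignRankSuperQP.stub_vdwHadamard`
— so SignRankSuperQP, and with it the binder SrkNotQP (20857) via `srkNotQP_of_signRankSuperQP`, is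
OPEN MODULO `stub_forsterSlice` ONLY (stub A: Forster's inequality for the permutation slice up to
polynomial loss — a k-term sign-representation forces one twist V with det V ≠ 0 and n!·per(V∘V) ≤
k^C·det(V)²; conjecture-grade, XL; tight at n = 2, consistent with srk(3..5) = 2, 2, 4). BINDER
LINES (rev 5, 2026-08-27): SrkNotQP (20857) carries the registered line `forster_slice`
(Cruxes/SrkNotQP/Lines/forster_slice.lean + .md, val-width-lines-3; = the birth skeleton re-homed on
the binder — `SrkNotQP_of_line : SrkNotQP` by name via `srkNotQP_of_signRankSuperQP`, stub B cited
by name, the ONE open stub `stub_forsterSlice` verbatim the birth signature, so one landing closes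
both registrations). FIRST-PROVER CALIBRATION (val-width-20857-p1,
Theorems/SliceSignRankSrkNotQPForsterSliceEquiv.lean + …ForsterSliceBalanced.lean, landed
`--supports` 20857): as registered, stub A quantifies the twist V INDEPENDENTLY of the
representation W, so together with `stub_vdwHadamard` it is EQUIVALENT to the factorial-power bound
«∃ C, ∀ n ≥ 3, a k-term sign-representation of sgn on S_n forces n! ≤ k^C»
(`forsterSlice_iff_factorialPowerLower`; log₂ srk(n) = Ω(n log n)) — an exponential-type statement
far STRONGER than SrkNotQP (best proved in the tree: n ≤ C·srk(n), support SignRankLinearLower;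
upper bound srk(n) ≤ n!); the balanced regime (all terms and all values within a factor B) obeys the
inequality with n!·per(V∘V) ≤ B³·k²·det(V)² (`forsterSlice_of_balanced`, Forster's three lines once
isotropy is granted; the slice has no GL_k isotropic-position step, only the positive torus). A
W-DEPENDENT reshaping of stub A (V chosen from the representation, poly(k) loss) is the line owner's
next move (write_cruxes 20857), not a route edit; the honest first sub-target below SRK∞ is still
SrkSuperlinear (srk(n) ≠ O(n), TWO-LAYER PLAN). PositiveSliceSignTransfer (20858): NO SKELETON by
design — RESIDUAL · HELD (see #302; Cruxes/PositiveSliceSignTransfer/NO-SKELETON.md). The card's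
Theorem B (k = 2 impossible for n ≥ 35, Radon blocks), Theorem D (threshold degree ≥ c·n of every
coboundary twist
sgn·β_S on the Birkhoff vertices, via Hadamard), the flattening-blindness lemma (rank-one sign
completion per bipartition) and the LP
recursion srk(n) ≥ ⌊n/m⌋(srk(m) − 1) + 1 are provable-now lemmas that provers attach with
`--supports SignRankSuperQP`; the exact
finite values srk(5) = 4, srk(6), srk(7) are computations (nonlinear feasibility — no Lean
certificate format yet), kept as evidence.
The card's UNRESTRICTED real normal form FNF_ℝ (all real slice VP families) is deliberately NOT
filed: block direct sums per_3^(⊕m)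
(in VP, zero coefficients off the block permutations) reduce it to the Y-rank of 1^(⊗m) over the
cubic hypersurface
Y = {y ∈ ℝ^(S_3) : Π_even y = −Π_odd y}, which may well be exponential; FNF⁺ excludes zeros and is
the weakest transfer the deciding
theorem needs. The complex/real window prediction W(n) (srk(n) > 2·tdr_ℂ(per_n) for some n) is a
calibration, not an item.

CHEAPEST FALSIFIER. (a) the small-n profile: srk(3) = 2, srk(4) = 2, srk(5) = 4 (card, kit j003249,
exact-verified); replicated in this unit for n = 3
(k = 1 infeasible with margin 0, k = 2 witness found) and n = 4 (k = 2 witness found) by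
srk_test.py; kit j018066 (this unit,
numpy softmin-margin search with exact rational re-verification) probes (5,3), (5,4), (6,4..7),
(7,7..10) — a sub-doubling trend
(srk(6) ≤ 4 and srk(7) ≤ 5) would make SRK implausible, srk(6) ≥ 7 would realise W(6); (b) a
literature construction of per-like
positive patterns from O(n) signed determinants (none found: the Pólya/SNS/conversion literature
stops at k = 1 — McCuaig2004,
RobertsonSeymourThomas1999, Brualdi–Shader, Dolinar–Guterman–Kuzma doi:10.1016/j.ejc.2010.07.001,
arXiv:2605.24349).

NUMBERS. srk(1) = srk(2) = 1; srk(3) = 2 (Pólya: k = 1 impossible from n = 3); srk(4) = 2; srk(5) =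
4 (card data); Theorem A: srk(n) ≥
n/4 − O(√(n log n)); Theorem B: srk(n) ≥ 3 for n ≥ 35; upper bounds: srk(n) ≤ tdr_ℝ(per_n) ≤ n!
trivially and ≤ 2^q(n) from sinh-product
constructions with q(n) ≤ C(n,2); tdr_ℂ(per_3) = 2 over ℚ(ζ_3) (route TwistedDetRank), ⌊n/3⌋ + 1 ≤
tdr_ℂ(per_n). Items at open: 9
(target, 2 cruxes, assembly, 5 supports).

DEFINITION REQUESTS. None needed: every item inlines the sign-representation predicate over
`Matrix`, `Equiv.Perm.sign` and
`Literature.Computability.AlgebraicComplexity.permMonomial`; a convenience notion `SrkLE n k` (∃ W :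
Fin k → Matrix (Fin n) (Fin n) ℝ,
∀ σ, 0 < sgn σ · Σ_t Π_i W t (σ i) i) may be filed later under
Summits/ValiantsHypothesis/ValiantsHypothesis/Theorems if provers want it.

Novelty: Searches (2026-08-16, this unit; searchd local index DOWN (rc 75), OpenAlex/S2 HTTP 429): `lit
search --source zbmath "Polya permanent problem"`
(10: RST99 doi:10.2307/121059, McCuaig2004, Dolinar–Guterman–Kuzma 2011, Budrevich–Guterman Gibson
bounds ×2, arXiv:2605.24349 q-permanent
Schur multipliers, Thomas 2006 survey, arXiv:2212.09348 — all single-map conversion), `lit search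
--source zbmath "permanent determinant
conversion sign"` (5: Brualdi–Shader 1991 SNS, Budrevich 2012/2014/2015 — k = 1), `lit search
--source arxiv "Polya permanent problem"`
(2: arXiv:2012.01278, arXiv:1003.1984), `lit search --source zbmath "sign-rank tensor"` (3
proceedings volumes, no paper),
`lit galaxy search "permanent as a sum of determinants" --star all` (0), `lit galaxy search
"sign-rank" --star pdf` (12, all Wilcoxon
signed-rank statistics), `lit frontier ValiantsHypothesis --since 2023` (30 rows; arXiv:2604.00766
coherent-state rank / approximate
multilinear formulas for per and arXiv:2601.09343 symmetric classes read p.1 — unrelated levers);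
plus the mechanism critic's searches of
2026-08-16 recorded on the card (zbMATH 'permanent as sum of determinants' 29 rows none k > 1
sign-only; galaxy intelligent on positive
permutation coefficients as sums of reweighted determinants → VY89/RST only). Route list: the 54
open/draft routes' levers tabulated in
NOTES.md — none uses coefficient-sign orthants, sign-rank, threshold degree on S_n or Radon
relations of B_n.
Nearest prior art found: route Tw  [refs: 10.2307/121059, 2605.24349, 2212.09348, 2012.01278, 1003.1984, 2604.00766, 2601.09343, doi:10.2307/121059, McCuaig2004, MarcusMinc1961, RobertsonSeymourThomas1999, Forster2002, RazborovSherstov2010, DafniEtAl2020, LoeblMasbaum2011]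

Barriers (technique_class: sign-rank-elimination, coefficient-sign-orthant): - technique_class: sign-rank-elimination, coefficient-sign-orthant
- Literature.Barriers.ValiantsHypothesis.AlgebraicNaturalProofs: evaded by construction on the SRK
side — the engine never produces a vanishing distinguisher; it lower-bounds an OPEN Zariski-dense
cone by sign certificates on coset cubes, and (conditionally on the window W(n), structurally
always) reaches beyond the real Zariski closure of the k-term model, where every distinguisher is
dead. Conceded: the transfer FNF⁺ may need equations of VP restricted to the slice.
- Literature.Barriers.ValiantsHypothesis.RankMethods: provably inapplicable and not used — every
bipartition of the rows admits a rank-one SIGN completion of the prescribed pattern, so no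
sub-additive rank measure certifies srk > 1 (EfremenkoGargOliveiraWigderson2018 ceilings are beside
the point); likewise RankLiftingBarrier, PartialDerivativesDetPerm, ShiftedPartialDerivatives,
UnpaddedShiftedPartials.
- Literature.Barriers.ValiantsHypothesis.MonotoneGap: does not apply — the k-determinant model is
maximally cancellative and PPC is not a monotone lower bound; the gap families (ST_n, planar
matchings) are positive patterns on Pfaffian supports (sign-type rank 1), the full permutation
support is not (K_{3,3}).
- Literature.Barriers.ValiantsHypothesis.NoncommutativeExtensions: respected, and it delimits the
engine — Mantel needs COMMUTING scalar twists (a scalar signing cannot be odd on all 2×2 blocks of a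
row pair); matrix twists anticommute and

History (route lifecycle, newest last):
- 2026-08-24T18:54:22Z · DORMANT — reconciler: no traction for 7 d (last activity item-evidence-added at 2026-08-17T18:35:40Z); parked, not closed — `ledger route dormant route-ValiantsHypothesis (operator:999:4015224)
- 2026-08-26T06:37:52Z · REACTIVATED — reconciler: reactivated — activity statement-closed at 2026-08-26T05:49:43Z after parking at 2026-08-24T18:54:22Z (operator:999:709205)
- 2026-09-03T13:36:38Z · DORMANT — reconciler: no traction for 5 d (last activity statement-checked at 2026-08-29T12:50:09Z); parked, not closed — `ledger route dormant route-ValiantsHypothesis-S (operator:999:3320790)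

sub-problem: ValiantsHypothesis · status: dormant · opened planner-plan-novel-ValiantsHypothesis-ValiantsH-5b693ca4-0 2026-08-16T13:53:58Z · rev 5 · ledger route-ValiantsHypothesis-SliceSignRank
GENERATED by the gate from the ledger (D-0016/17). Provers cite these decls: `theorem foo : Summit.ValiantsHypothesis.ValiantsHypothesis.Theses.SliceSignRank.<Decl> := …` in Summits/ValiantsHypothesis/ValiantsHypothesis/Theorems/<Name>.lean.
-/

namespace Summit.ValiantsHypothesis.ValiantsHypothesis.Theses.SliceSignRank

open scoped BigOperators Topology Manifold Classical MeasureTheory ProbabilityTheory Matrix InnerProductSpace ComplexConjugate ContinuousMap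
open Filter Set Function TopologicalSpace MeasureTheory

attribute [summit_statement] _root_.ValiantsHypothesis

open Literature.PNP

/-- item stmt-ValiantsHypothesis-15117 · target · rank 0 · open · by planner
why it might fail: strictly stronger than VH: ONE easy all-positive slice family kills it — candidates whose complexity is open: q-determinants Σ q^inv(σ) x^σ (q > 0, q ≠ 1; arXiv:2605.24349), positive fermionants Σ t^cyc(σ) x^σ.
sources: MarcusMinc1961, McCuaig2004, RobertsonSeymourThomas1999, Valiant1979, arXiv:2605.24349
[target] PPC in family form: a family f_n ∈ ℂ[x_ij] supported on the permutation monomials with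
every permutation coefficient real and positive is not a VP family (card thesis PPC; per_n is the
all-ones instance). -/
@[route_item "route-ValiantsHypothesis-SliceSignRank"]
def PositivePatternHard : Prop :=
  ∀ f : (n : ℕ) → MvPolynomial (Fin n × Fin n) ℂ, (∀ (n : ℕ) (d : Fin n × Fin n →₀ ℕ), (∀ ρ : Equiv.Perm (Fin n), Literature.Computability.AlgebraicComplexity.permMonomial ρ ≠ d) → MvPolynomial.coeff d (f n) = 0) → (∀ (n : ℕ) (ρ : Equiv.Perm (Fin n)), ∃ r : ℝ, 0 < r ∧ MvPolynomial.coeff (Literature.Computability.AlgebraicComplexity.permMonomial ρ) (f n) = (r : ℂ)) → ¬ Literature.Computability.AlgebraicComplexity.IsVPFamily f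

/-- item stmt-ValiantsHypothesis-15118 · crux · rank 2 · open · by planner
why it might fail: every product-structure restriction (coset cubes, S_m^r cosets, LP recursion) caps the engine at O(n); single signings are exponential (Thm D) but a MIXED-signing scheme with k = O(n) or poly(n) terms (as in the n = 4, k = 2 witness) is not excluded by anything proved.
sources: Forster2002, RazborovSherstov2010, MarcusMinc1961, LoeblMasbaum2011, DafniEtAl2020
[crux] SRK (card K1): the sign-rank with don't-cares of the Levi-Civita tensor is not
quasi-polynomially bounded — for every c, for all large n, no k ≤ 2^((log₂ n + c)^c) real matrices
W_1..W_k ∈ ℝ^(n×n) satisfy sgn σ · Σ_t Π_i W_t(σ(i), i) > 0 for every σ ∈ S_n (equivalently: no sum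
of k real Hadamard-twisted determinants has all n! permutation coefficients positive). [difficulty:
open-problem] -/
@[route_item "route-ValiantsHypothesis-SliceSignRank"]
def SignRankSuperQP : Prop :=
  ∀ c : ℕ, ∃ n₀ : ℕ, ∀ n ≥ n₀, ∀ k ≤ 2 ^ ((Nat.log 2 n + c) ^ c), ¬ ∃ W : Fin k → Matrix (Fin n) (Fin n) ℝ, ∀ σ : Equiv.Perm (Fin n), 0 < ((Equiv.Perm.sign σ : ℤ) : ℝ) * ∑ t, ∏ i, W t (σ i) i

/-- item stmt-ValiantsHypothesis-15119 · crux · rank 3 · SPLIT (gen 1) into SrkNotQP, PositiveSliceSignTransfer + glue Summit.ValiantsHypothesis.ValiantsHypothesis.Theorems.SliceSignRankPositiveSliceNormalFormSplitGlue.positiveSliceNormalForm_of_subs · direct attempts still welcome (low priority) · by planner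
why it might fail: structural transfer with no mechanism yet; given SRK it is equivalent to PPC, so one easy positive slice family of large real twisted rank (q-determinant, if easy) kills it; a proof may need equations of VP on the slice, blind to cancellation of non-permutation monomials.
sources: Valiant1979, Burgisser2000, HrubesYehudayoff2011, Tesler2000, Curticapean2021
[crux] FNF⁺ (card K2 restricted to the positive orthant, the weakest transfer under which SRK
decides VH): for every VP_ℂ family f supported on the permutation slice with all permutation
coefficients real and positive there is c such that for all n ≥ 1 the coefficient function is a REAL
fermionic sum of length k ≤ 2^((log₂ n + c)^c): coeff(x^σ, f_n) = sgn σ · Σ_(t<k) Π_i W_t(σ(i), i)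
with W_t ∈ ℝ^(n×n) — i.e. f_n = Σ_t det(W_t ∘ X) (support TwistedSumForm). [deps: SignRankSuperQP]
[difficulty: open-problem] -/
@[route_item "route-ValiantsHypothesis-SliceSignRank"]
def PositiveSliceNormalForm : Prop :=
  ∀ f : (n : ℕ) → MvPolynomial (Fin n × Fin n) ℂ, (∀ (n : ℕ) (d : Fin n × Fin n →₀ ℕ), (∀ ρ : Equiv.Perm (Fin n), Literature.Computability.AlgebraicComplexity.permMonomial ρ ≠ d) → MvPolynomial.coeff d (f n) = 0) → (∀ (n : ℕ) (ρ : Equiv.Perm (Fin n)), ∃ r : ℝ, 0 < r ∧ MvPolynomial.coeff (Literature.Computability.AlgebraicComplexity.permMonomial ρ) (f n) = (r : ℂ)) → Literature.Computability.AlgebraicComplexity.IsVPFamily f → ∃ c : ℕ, ∀ n : ℕ, 1 ≤ n → ∃ k ≤ 2 ^ ((Nat.log 2 n + c) ^ c), ∃ W : Fin k → Matrix (Fin n) (Fin n) ℝ, ∀ σ : Equiv.Perm (Fin n), MvPolynomial.coeff (Literature.Computability.AlgebraicComplexity.permMonomial σ) (f n) = ((Equiv.Perm.sign σ : ℤ)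 : ℂ) * ∑ t, ∏ i, ((W t (σ i) i : ℝ) : ℂ)

-- parent: PositiveSliceNormalForm · child (gen 1)
/--     item stmt-ValiantsHypothesis-20857 · crux · rank 301 · open
    parent: PositiveSliceNormalForm · by planner
    why it might fail: a MIXED-sign scheme with poly(n) product terms may exist for all large n (cancellations help: srk(4) = 2 < 3 = positive-orthant bound); every known engine (Marcus–Minc, Forster-type) caps at k = O(n), far below quasi-polynomial.
    sources: Forster2002, RazborovSherstov2010, MarcusMinc1961, LoeblMasbaum2011
[crux] SRK∞ (infinitely-often sign-rank hardness of sgn): for every c there is an n ≥ 1 such that NO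
family of k ≤ 2^((log₂ n + c)^c) real n×n matrices W_t realises sgn(σ)·Σ_t Π_i W_t(σ i, i) > 0 for
all σ ∈ S_n. The i.o. weakening of SignRankSuperQP (stmt-15118 ⇒ this, landed
`srkNotQP_of_signRankSuperQP`); first piece of the BC2 redirect of PositiveSliceNormalForm
(hypothesis 1 of the landed glue `positiveSliceNormalForm_of_subs`, verbatim). -/
@[route_item "route-ValiantsHypothesis-SliceSignRank"]
def SrkNotQP : Prop :=
  ∀ c : ℕ, ∃ n : ℕ, 1 ≤ n ∧ ∀ k ≤ 2 ^ ((Nat.log 2 n + c) ^ c), ¬ ∃ W : Fin k → Matrix (Fin n) (Fin n) ℝ, ∀ σ : Equiv.Perm (Fin n), 0 < ((Equiv.Perm.sign σ : ℤ) : ℝ) * ∑ t, ∏ i, W t (σ i) i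

-- parent: PositiveSliceNormalForm · child (gen 1)
/--     item stmt-ValiantsHypothesis-20858 · crux · rank 302 · open
    parent: PositiveSliceNormalForm · by planner
    why it might fail: one EASY positive-slice family of super-quasi-polynomial sign-rank kills it (candidates: positive fermionants / q-determinants if any is in VP); no transfer mechanism from circuits to sign-representations is known beyond read-once/multilinear normal forms.
    sources: Valiant1979, Burgisser2000, HrubesYehudayoff2011, arXiv:2605.24349
[crux] SGN-TRANSFER: every VP family supported on the permutation slice with strictly POSITIVE real
coefficients admits, for all n ≥ 1, a real sign-representation of sgn(σ) of quasi-polynomial length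
k ≤ 2^((log₂ n + c)^c) (sgn(σ)·Σ_t Π_i W_t(σ i, i) > 0). Second piece of the BC2 redirect of
PositiveSliceNormalForm (hypothesis 2 of the landed glue `positiveSliceNormalForm_of_subs`,
verbatim); implied by PositiveSliceNormalForm and by PositivePatternHard (landed calibrations in
Theorems/SliceSignRankPositiveSliceNormalFormSplit.lean). -/
@[route_item "route-ValiantsHypothesis-SliceSignRank"]
def PositiveSliceSignTransfer : Prop :=
  ∀ f : (n : ℕ) → MvPolynomial (Fin n × Fin n) ℂ, (∀ (n : ℕ) (d : Fin n × Fin n →₀ ℕ), (∀ ρ : Equiv.Perm (Fin n), Literature.Computability.AlgebraicComplexity.permMonomial ρ ≠ d) → MvPolynomial.coeff d (f n) = 0) → (∀ (n : ℕ) (ρ : Equiv.Perm (Fin n)), ∃ r : ℝ, 0 < r ∧ MvPolynomial.coeff (Literature.Computability.AlgebraicComplexity.permMonomial ρ) (f n) = (r : ℂ)) → Literature.Computability.AlgebraicComplexity.IsVPFamily f → ∃ c : ℕ, ∀ n : ℕ, 1 ≤ n → ∃ k ≤ 2 ^ ((Nat.log 2 n + c) ^ c), ∃ W : Fin k → Matrix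 (Fin n) (Fin n) ℝ, ∀ σ : Equiv.Perm (Fin n), 0 < ((Equiv.Perm.sign σ : ℤ) : ℝ) * ∑ t, ∏ i, W t (σ i) i

/-- glue for the split of `PositiveSliceNormalForm`: landed theorem `Summit.ValiantsHypothesis.ValiantsHypothesis.Theorems.SliceSignRankPositiveSliceNormalFormSplitGlue.positiveSliceNormalForm_of_subs`. -/
theorem PositiveSliceNormalFormGlueBy_holds : SrkNotQP → PositiveSliceSignTransfer → PositiveSliceNormalForm := _root_.Summit.ValiantsHypothesis.ValiantsHypothesis.Theorems.SliceSignRankPositiveSliceNormalFormSplitGlue.positiveSliceNormalForm_of_subs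

/-- item stmt-ValiantsHypothesis-15120 · support · rank 9 · closed · proved by Summit.ValiantsHypothesis.ValiantsHypothesis.Theorems.SliceSignRank.cruxesToTarget_proof (prover) · by planner
sources: Valiant1979
[support] SRK and FNF⁺ give PPC: a positive slice VP family would have quasi-polynomial real
sign-representations of sgn for all n ≥ 1, contradicting SRK at n = max(n₀, 1) (pure logic; planner
Sketch.lean `cruxesToTarget_holds`). [difficulty: provable-now] -/
@[route_item "route-ValiantsHypothesis-SliceSignRank"]
def CruxesToTarget : Prop :=
  SignRankSuperQP → PositiveSliceNormalForm → PositivePatternHard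

-- `CruxesToTarget` holds: proved by `Summit.ValiantsHypothesis.ValiantsHypothesis.Theorems.SliceSignRank.cruxesToTarget_proof` (its module imports this route file, so no `_holds` link can be stated here).

/-- item stmt-ValiantsHypothesis-15121 · support · rank 9 · closed · proved by Summit.ValiantsHypothesis.ValiantsHypothesis.Theorems.SliceSignRank.targetToVH_proof (prover) · by planner
sources: Valiant1979, Burgisser2000
[support] PPC decides the summit: per_n is supported on the permutation monomials with all
coefficients 1 (`coeff_perPoly`, `coeff_permMonomial_perPoly`), per ∈ VNP
(`perFamily_mem_VNP_holds`) and the renaming bridge `mem_VP_ofFintype_iff_holds` turn VP ℂ = VNP ℂ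
into IsVPFamily per, contradicting PPC. [difficulty: provable-now] -/
@[route_item "route-ValiantsHypothesis-SliceSignRank"]
def TargetToVH : Prop :=
  PositivePatternHard → _root_.ValiantsHypothesis

-- `TargetToVH` holds: proved by `Summit.ValiantsHypothesis.ValiantsHypothesis.Theorems.SliceSignRank.targetToVH_proof` (its module imports this route file, so no `_holds` link can be stated here).

/-- item stmt-ValiantsHypothesis-15122 · support · rank 9 · closed · proved by Summit.ValiantsHypothesis.ValiantsHypothesis.Theorems.SliceSignRank.signRankLinearLower_proof (prover) · by planner
sources: Forster2002, MarcusMinc1961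
[support] card Theorem A in O-form (the engine's first theorem): there is an absolute C with n ≤ C·k
whenever k real twists sign-represent sgn on S_n (card: srk(n) ≥ n/4 − O(√(n log n)) by coset-cube
elimination + Mantel + random pairing; k ≥ 1 always since the empty sum is 0). [difficulty: M] -/
@[route_item "route-ValiantsHypothesis-SliceSignRank"]
def SignRankLinearLower : Prop :=
  ∃ C : ℕ, ∀ n k : ℕ, (∃ W : Fin k → Matrix (Fin n) (Fin n) ℝ, ∀ σ : Equiv.Perm (Fin n), 0 < ((Equiv.Perm.sign σ : ℤ) : ℝ) * ∑ t, ∏ i, W t (σ i) i) → n ≤ C * k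

-- `SignRankLinearLower` holds: proved by `Summit.ValiantsHypothesis.ValiantsHypothesis.Theorems.SliceSignRank.signRankLinearLower_proof` (its module imports this route file, so no `_holds` link can be stated here).

/-- item stmt-ValiantsHypothesis-15123 · support · rank 9 · closed · proved by Summit.ValiantsHypothesis.ValiantsHypothesis.Theorems.SliceSignRank.polyaOneTwist_proof (prover) · by planner
sources: MarcusMinc1961, McCuaig2004
[support] Pólya / Marcus–Minc in sign form: for n ≥ 3 no single real twist W has sgn σ · Π_i W(σ(i),
i) > 0 for all σ (restrict to S_3 ⊕ id; the products over even and over odd permutations of the 3×3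
block coincide but carry opposite signs). [difficulty: provable-now] -/
@[route_item "route-ValiantsHypothesis-SliceSignRank"]
def PolyaOneTwist : Prop :=
  ∀ n ≥ 3, ¬ ∃ W : Matrix (Fin n) (Fin n) ℝ, ∀ σ : Equiv.Perm (Fin n), 0 < ((Equiv.Perm.sign σ : ℤ) : ℝ) * ∏ i, W (σ i) i

-- `PolyaOneTwist` holds: proved by `Summit.ValiantsHypothesis.ValiantsHypothesis.Theorems.SliceSignRank.polyaOneTwist_proof` (its module imports this route file, so no `_holds` link can be stated here).

/-- item stmt-ValiantsHypothesis-15124 · support · rank 9 · closed · proved by Summit.ValiantsHypothesis.ValiantsHypothesis.Theorems.SliceSignRank.twistedSumForm_proof (prover) · by planner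
sources: Burgisser2000, MarcusMinc1961
[support] dictionary (folklore, `Matrix.det_apply'` + distinctness of permutation monomials): for a
slice-supported f ∈ ℂ[x_ij] and real twists W_1..W_k, the coefficient identity coeff(x^σ, f) = sgn σ
· Σ_t Π_i W_t(σ(i), i) for all σ holds iff f = Σ_t det(W_t ∘ X) as polynomials. [difficulty:
provable-now] -/
@[route_item "route-ValiantsHypothesis-SliceSignRank"]
def TwistedSumForm : Prop :=
  ∀ (n k : ℕ) (W : Fin k → Matrix (Fin n) (Fin n) ℝ) (f : MvPolynomial (Fin n × Fin n) ℂ), (∀ d : Fin n × Fin n →₀ ℕ, (∀ ρ : Equiv.Perm (Fin n), Literature.Computability.AlgebraicComplexity.permMonomial ρ ≠ d) → MvPolynomial.coeff d f = 0) → ((∀ σ : Equiv.Perm (Fin n), MvPolynomial.coeff (Literature.Computability.AlgebraicComplexity.permMonomial σ) f = ((Equiv.Perm.sign σ : ℤ) : ℂ) * ∑ t, ∏ i, ((W t (σ i) i : ℝ) : ℂ)) ↔ f = ∑ t, (Matrix.of fun a b => MvPolynomial.C ((W t a b : ℝ) : ℂ) * (MvPolynomial.X (a, b) : MvPolynomial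 (Fin n × Fin n) ℂ)).det)

-- `TwistedSumForm` holds: proved by `Summit.ValiantsHypothesis.ValiantsHypothesis.Theorems.SliceSignRank.twistedSumForm_proof` (its module imports this route file, so no `_holds` link can be stated here).

/-- item stmt-ValiantsHypothesis-15125 · assembly · rank 1 · closed · proved by Summit.ValiantsHypothesis.ValiantsHypothesis.Theorems.SliceSignRank.assembly_proof (prover) · by planner
sources: Valiant1979, Burgisser2000
[assembly] SignRankSuperQP → PositiveSliceNormalForm → ValiantsHypothesis. -/
@[route_item "route-ValiantsHypothesis-SliceSignRank"]
def Assembly : Prop :=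
  SignRankSuperQP → PositiveSliceNormalForm → _root_.ValiantsHypothesis

-- `Assembly` holds: proved by `Summit.ValiantsHypothesis.ValiantsHypothesis.Theorems.SliceSignRank.assembly_proof` (its module imports this route file, so no `_holds` link can be stated here).

/-! D-0027 §2.1 — DECIDING THEOREM (planner-authored via `route open/edit --closes-file`; by planner-tenure-valiant-dormant-sweep-g2-0 2026-08-27T18:24:11Z):
its hypotheses are this route's items and its conclusion the sub-problem Statement (glue_lint), and it elaborates with this file. -/

/-- DECIDING THEOREM (D-0027 §2.1), rev 3 (tenure g2, director-valiant g8 2026-08-27T17:52:55Z (d)):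
`closes` consumes the SPLIT CHILDREN of `PositiveSliceNormalForm` — `SrkNotQP` (stmt-20857) and
`PositiveSliceSignTransfer` (stmt-20858) — and derives the parent through the landed glue
`PositiveSliceNormalFormGlueBy_holds` (= `…SliceSignRankPositiveSliceNormalFormSplitGlue.positiveSliceNormalForm_of_subs`).
`SignRankSuperQP` (stmt-15118, the a.e. form) is no longer a binder: it implies `SrkNotQP`
(`…SliceSignRankPositiveSliceNormalFormSplit.srkNotQP_of_signRankSuperQP`) and only the i.o. form is
needed. Logic: if `VP ℂ = VNP ℂ` then `per ∈ VP` (Valiant's `perFamily_mem_VNP_holds` + the bundling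
bridge `mem_VP_ofFintype_iff_holds`); `per` is a positive slice family (coefficient 1 on every
permutation monomial, 0 elsewhere: `coeff_perPoly`, `coeff_permMonomial_perPoly`), so the derived
`PositiveSliceNormalForm` gives `c` and, for every `n ≥ 1`, a real fermionic sum of length
`k ≤ 2^((log₂ n + c)^c)` with `sgn σ · Σ_t Π_i W_t(σ i, i) = 1 > 0`; `SrkNotQP` at `c` supplies an
`n ≥ 1` where no such sign-representation exists. Axioms: propext, Classical.choice, Quot.sound. -/
@[closes "route-ValiantsHypothesis-SliceSignRank"] theorem closes (hK : SrkNotQP) (hT : PositiveSliceSignTransfer) : _root_.ValiantsHypothesis := by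
  have hF : PositiveSliceNormalForm := PositiveSliceNormalFormGlueBy_holds hK hT
  show Literature.Computability.AlgebraicComplexity.VP ℂ ≠ Literature.Computability.AlgebraicComplexity.VNP ℂ
  intro hEq
  have hbridge : Literature.Computability.AlgebraicComplexity.perFamily ℂ ∈
      Literature.Computability.AlgebraicComplexity.VP ℂ ↔
      Literature.Computability.AlgebraicComplexity.IsVPFamily
        (fun n => Literature.Computability.AlgebraicComplexity.perPoly (Fin n) ℂ) :=
    Literature.Computability.AlgebraicComplexity.mem_VP_ofFintype_iff_holds _
  have hVP : Literature.Computability.AlgebraicComplexity.IsVPFamily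
      (fun n => Literature.Computability.AlgebraicComplexity.perPoly (Fin n) ℂ) := by
    refine hbridge.1 ?_
    rw [hEq]
    exact Literature.Computability.AlgebraicComplexity.perFamily_mem_VNP_holds ℂ
  -- the permanent is a positive slice family: supported on permutation monomials, coefficient 1 each
  have h0 : ∀ (n : ℕ) (d : Fin n × Fin n →₀ ℕ),
      (∀ ρ : Equiv.Perm (Fin n), Literature.Computability.AlgebraicComplexity.permMonomial ρ ≠ d) →
        MvPolynomial.coeff d (Literature.Computability.AlgebraicComplexity.perPoly (Fin n) ℂ) = 0 := by
    intro n d hd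
    rw [Literature.Computability.AlgebraicComplexity.coeff_perPoly]
    exact Finset.sum_eq_zero fun ρ _ => if_neg (hd ρ)
  have h1 : ∀ (n : ℕ) (ρ : Equiv.Perm (Fin n)), ∃ r : ℝ, 0 < r ∧
      MvPolynomial.coeff (Literature.Computability.AlgebraicComplexity.permMonomial ρ)
        (Literature.Computability.AlgebraicComplexity.perPoly (Fin n) ℂ) = (r : ℂ) := by
    intro n ρ
    refine ⟨1, one_pos, ?_⟩
    rw [Literature.Computability.AlgebraicComplexity.coeff_permMonomial_perPoly]
    simp
  -- transfer (derived parent): a quasi-polynomial real fermionic normal form of per_n for all n ≥ 1 …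
  obtain ⟨c, hc⟩ := hF _ h0 h1 hVP
  -- … which SrkNotQP forbids at its witness n ≥ 1 for this c
  obtain ⟨n, hn1, hn⟩ := hK c
  obtain ⟨k, hk, W, hW⟩ := hc n hn1
  refine hn k hk ⟨W, fun σ => ?_⟩
  have h := hW σ
  rw [Literature.Computability.AlgebraicComplexity.coeff_permMonomial_perPoly] at h
  have h' : (((Equiv.Perm.sign σ : ℤ) : ℝ) * ∑ t, ∏ i, W t (σ i) i : ℝ) = 1 := by
    apply Complex.ofReal_injective
    push_cast
    exact h.symm
  rw [h']
  exact one_pos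

end Summit.ValiantsHypothesis.ValiantsHypothesis.Theses.SliceSignRank
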